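import Summits.CriticalPhenomena.PercolationContinuityZ3.Theorems.PercNearOneGluingNoHeavyLowerTailSahiSharedChain
import Mathlib.Data.Prod.Lex
import Mathlib.Tactic.Linarith
import Mathlib.Tactic.Ring
import HarnessLib

/-!
# `NoHeavyLowerTail` (crux stmt-CriticalPhenomena-4575), master-family line P2 — T₁ WITH `|C| = 1`, THE `z`-DOMINATED HALF:
# Kahn's `C_3` for `f(z,c,a), g(z,c,b), h(z,a,b)` whenever `f(0,1,·) ≤ f(1,0,·)` and `g(0,1,·) ≤ g(1,0,·)` (THEOREM C read lexicographically)

Memo SAHI-ROUTE.md §4.50 / `FROM-prim-masterthm-p2-g26-LEX-CHAIN.md` (seat `prim-masterthm-p2`, gen 26; `--supports stmt-CriticalPhenomena-4575`).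
No `sorry`, no named facts, standard axioms.

SETTING (the first stratum of Kahn's Conjecture 5 beyond THEOREM A; SAHI-ROUTE §4.49(f)).  `T₁(|C| = 1)` is the class of triples
`f(z,c,a), g(z,c,b), h(z,a,b)`: the coin `z` is seen by all three members, the coin `c` by `f` and `g` only, and `a ∈ α`, `b ∈ β` are
independent FKG blocks.  The `f`–`g` block `γ = {z,c}` is the square `2 × 2`, NOT a chain, so THEOREM C (`…SahiSharedChain`, the `f`–`g`
block a chain, `h` arbitrary) does not apply to it as a sub-cube.  OBSERVATION (this file): THEOREM C never uses the cube order of `γ` — only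
that `f, g, h` are monotone along SOME linear order of `γ` carrying an arbitrary positive probability weight.  Read `γ = {z,c}` through the
LEXICOGRAPHIC order `(0,0) < (0,1) < (1,0) < (1,1)` (`z` the senior letter): `h(z,a,b)` is automatically monotone along it, and `f` is
monotone along it iff `f(0,1,a) ≤ f(1,0,a)` for every `a` ("`z` DOMINATES `c` in `f`": switching `z` on does at least as much as switching
`c` on).  Hence:

**THEOREM (`sahiE_three_nonneg_lexChain`).**  `δ₁, δ₂` finite nonempty chains, `wC > 0` ANY probability weight on `δ₁ × δ₂`, `α, β` FKG;
`f(z,c,a), g(z,c,b)` nonnegative, monotone in `c`, `a` / `b`, and `z`-DOMINATED (`z < z' ⟹ f(z,c,a) ≤ f(z',c',a)` for all `c, c'`);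
`h(z,a,b)` nonnegative monotone (free of `c`).  Then `E_3(f,g,h) ≥ 0`.

**COROLLARY (`sahiE_three_nonneg_T1_zdom`, `δ₁ = δ₂ = Fin 2`, any positive weight on the square; `sahiE_three_nonneg_T1_zdom_coins` for
the product weight of two coins).**  Kahn's `C_3` holds on `T₁(|C| = 1)` whenever `f(0,1,·) ≤ f(1,0,·)` and `g(0,1,·) ≤ g(1,0,·)`.

WHAT IS LEFT OF `T₁(|C| = 1)` (exactly): the triples in which `f` (or `g`) has a section `a` with `f(0,1,a) = 1, f(1,0,a) = 0` — at such
`a` the member reads `f(·,·,a) = c`, the ANTICHAIN pattern `{01,11}` of the `(z,c)`-diamond (memo g25 §10: "the nested forms on the two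
chains of the diamond must pay for the crossed form on its antichain").  The `z`-dominated half is the chain-compatible half; its complement
is the genuinely two-dimensional residue (census: `β₁₁ > 0` strictly there, exp. g25/g26). [this work]
-/

noncomputable section

open scoped Classical

namespace Summit.CriticalPhenomena.PercolationContinuityZ3.Theorems

namespace SahiT1Lex

open Finset
open Literature.Combinatorics.Sahi2008

variable {α β δ₁ δ₂ : Type} [Fintype α] [Fintype β] [Fintype δ₁] [Fintype δ₂]

/-- **THEOREM C READ LEXICOGRAPHICALLY.**  `α, β` FKG lattices; `δ₁, δ₂` finite nonempty linear orders; `wC` any strictly positive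
probability weight on `δ₁ × δ₂`; `f(z,c,a)`, `g(z,c,b)` nonnegative, monotone in `c` and in the block variable, and `z`-DOMINATED
(`z < z'` forces `f(z,c,a) ≤ f(z',c',a)` for all `c, c'`); `h(z,a,b)` nonnegative and monotone in every argument (it does not see `c`).
Then `E_3(f,g,h) ≥ 0` under `wA ⊗ wB ⊗ wC`.  Proof: `…SahiSharedChain.sahiE_three_nonneg_sharedChain'` on the chain `δ₁ ×ₗ δ₂`. [this work] -/
theorem sahiE_three_nonneg_lexChain [DistribLattice α] [DistribLattice β] [LinearOrder δ₁] [LinearOrder δ₂]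
    [Nonempty δ₁] [Nonempty δ₂]
    {wA : α → ℝ} {wB : β → ℝ} {wC : δ₁ × δ₂ → ℝ}
    {f : δ₁ → δ₂ → α → ℝ} {g : δ₁ → δ₂ → β → ℝ} {h : δ₁ → α → β → ℝ}
    (hA : IsFKGMeasure wA) (hB : IsFKGMeasure wB) (hC : ∀ x, 0 < wC x) (hC1 : ∑ x, wC x = 1)
    (hf0 : ∀ z c a, 0 ≤ f z c a) (hfa : ∀ z c, Monotone (f z c)) (hfc : ∀ z a, Monotone (fun c => f z c a))
    (hfdom : ∀ z z', z < z' → ∀ c c' a, f z c a ≤ f z' c' a)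
    (hg0 : ∀ z c b, 0 ≤ g z c b) (hgb : ∀ z c, Monotone (g z c)) (hgc : ∀ z b, Monotone (fun c => g z c b))
    (hgdom : ∀ z z', z < z' → ∀ c c' b, g z c b ≤ g z' c' b)
    (hh0 : ∀ z a b, 0 ≤ h z a b) (hhz : ∀ a b, Monotone (fun z => h z a b))
    (hha : ∀ z b, Monotone (fun a => h z a b)) (hhb : ∀ z a, Monotone (h z a)) :
    0 ≤ sahiE (fun q : α × β × (δ₁ × δ₂) => wA q.1 * wB q.2.1 * wC q.2.2) 3
        ![fun q => f q.2.2.1 q.2.2.2 q.1, fun q => g q.2.2.1 q.2.2.2 q.2.1, fun q => h q.2.2.1 q.1 q.2.1] := by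
  -- monotonicity along the lexicographic order of `δ₁ × δ₂`
  have lexmono : ∀ {φ : δ₁ → δ₂ → ℝ}, (∀ z, Monotone (φ z)) → (∀ z z', z < z' → ∀ c c', φ z c ≤ φ z' c') →
      Monotone (fun x : δ₁ ×ₗ δ₂ => φ (ofLex x).1 (ofLex x).2) := by
    intro φ hmono hdom x y hxy
    have hxy' : toLex (ofLex x) ≤ toLex (ofLex y) := by simpa using hxy
    rcases Prod.Lex.toLex_le_toLex.1 hxy' with hlt | ⟨heq, hle⟩
    · exact hdom _ _ hlt _ _
    · show φ (ofLex x).1 (ofLex x).2 ≤ φ (ofLex y).1 (ofLex y).2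
      rw [heq]; exact hmono _ hle
  have key := SahiSharedChain.sahiE_three_nonneg_sharedChain' (γ := δ₁ ×ₗ δ₂) (wA := wA) (wB := wB)
    (wC := fun x => wC (ofLex x))
    (f := fun x a => f (ofLex x).1 (ofLex x).2 a) (g := fun x b => g (ofLex x).1 (ofLex x).2 b)
    (h := fun x a b => h (ofLex x).1 a b)
    hA hB (fun x => hC _) (by rw [← hC1]; exact ofLex.sum_comp (fun x => wC x))
    (fun x a => hf0 _ _ a) (fun x => hfa _ _) (fun a => lexmono (fun z => hfc z a) (fun z z' hzz c c' => hfdom z z' hzz c c' a))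
    (fun x b => hg0 _ _ b) (fun x => hgb _ _) (fun b => lexmono (fun z => hgc z b) (fun z z' hzz c c' => hgdom z z' hzz c c' b))
    (fun x a b => hh0 _ a b)
    (fun a b => lexmono (φ := fun z _ => h z a b) (fun z c c' _ => le_rfl) (fun z z' hzz c c' => hhz a b hzz.le))
    (fun x b => hha _ b) (fun x a => hhb _ a)
  exact key

/-- **KAHN'S `C_3` ON THE `z`-DOMINATED HALF OF `T₁(|C| = 1)`.**  `α, β` FKG lattices; `wC` any strictly positive probability weight on the
`(z,c)`-square `Fin 2 × Fin 2`; `f(z,c,a)`, `g(z,c,b)`, `h(z,a,b)` nonnegative and monotone in every argument, with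
`f(0,1,a) ≤ f(1,0,a)` for every `a` and `g(0,1,b) ≤ g(1,0,b)` for every `b` (`z` dominates `c` in both).  Then `E_3(f,g,h) ≥ 0` under
`wA ⊗ wB ⊗ wC`. [this work] -/
theorem sahiE_three_nonneg_T1_zdom [DistribLattice α] [DistribLattice β]
    {wA : α → ℝ} {wB : β → ℝ} {wC : Fin 2 × Fin 2 → ℝ}
    {f : Fin 2 → Fin 2 → α → ℝ} {g : Fin 2 → Fin 2 → β → ℝ} {h : Fin 2 → α → β → ℝ}
    (hA : IsFKGMeasure wA) (hB : IsFKGMeasure wB) (hC : ∀ x, 0 < wC x) (hC1 : ∑ x, wC x = 1)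
    (hf0 : ∀ z c a, 0 ≤ f z c a) (hfa : ∀ z c, Monotone (f z c)) (hfc : ∀ z a, Monotone (fun c => f z c a))
    (hfdom : ∀ a, f 0 1 a ≤ f 1 0 a)
    (hg0 : ∀ z c b, 0 ≤ g z c b) (hgb : ∀ z c, Monotone (g z c)) (hgc : ∀ z b, Monotone (fun c => g z c b))
    (hgdom : ∀ b, g 0 1 b ≤ g 1 0 b)
    (hh0 : ∀ z a b, 0 ≤ h z a b) (hhz : ∀ a b, Monotone (fun z => h z a b))
    (hha : ∀ z b, Monotone (fun a => h z a b)) (hhb : ∀ z a, Monotone (h z a)) :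
    0 ≤ sahiE (fun q : α × β × (Fin 2 × Fin 2) => wA q.1 * wB q.2.1 * wC q.2.2) 3
        ![fun q => f q.2.2.1 q.2.2.2 q.1, fun q => g q.2.2.1 q.2.2.2 q.2.1, fun q => h q.2.2.1 q.1 q.2.1] := by
  -- on `Fin 2`, `z < z'` means `z = 0, z' = 1`; then `φ 0 c ≤ φ 0 1 ≤ φ 1 0 ≤ φ 1 c'`
  have dom : ∀ {φ : Fin 2 → Fin 2 → ℝ}, (∀ z, Monotone (φ z)) → φ 0 1 ≤ φ 1 0 →
      ∀ z z' : Fin 2, z < z' → ∀ c c', φ z c ≤ φ z' c' := by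
    intro φ hmono hd z z' hzz c c'
    have hz : z = 0 := by
      rcases Fin.exists_fin_two.mp ⟨z, rfl⟩ with h0 | h1
      · exact h0
      · exfalso; rw [h1] at hzz; exact absurd (Fin.le_last z') (not_le.mpr hzz)
    have hz' : z' = 1 := by
      rcases Fin.exists_fin_two.mp ⟨z', rfl⟩ with h0 | h1
      · exfalso; rw [h0] at hzz; exact absurd (Fin.zero_le z) (not_le.mpr hzz)
      · exact h1
    subst hz; subst hz'
    calc φ 0 c ≤ φ 0 1 := hmono 0 (Fin.le_last c)
      _ ≤ φ 1 0 := hd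
      _ ≤ φ 1 c' := hmono 1 (Fin.zero_le c')
  exact sahiE_three_nonneg_lexChain hA hB hC hC1 hf0 hfa hfc
    (fun z z' hzz c c' a => dom (fun z => hfc z a) (hfdom a) z z' hzz c c')
    hg0 hgb hgc (fun z z' hzz c c' b => dom (fun z => hgc z b) (hgdom b) z z' hzz c c') hh0 hhz hha hhb

/-- **KAHN'S `C_3` ON THE `z`-DOMINATED HALF OF `T₁(|C| = 1)`, two-coin form**: the `(z,c)`-block carries the product of two coins of
biases `t` (for `z`) and `s` (for `c`), `t, s ∈ (0,1)`; `α, β` FKG; `f(0,1,·) ≤ f(1,0,·)`, `g(0,1,·) ≤ g(1,0,·)`.  Then `E_3(f,g,h) ≥ 0`.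
[this work] -/
theorem sahiE_three_nonneg_T1_zdom_coins [DistribLattice α] [DistribLattice β]
    {wA : α → ℝ} {wB : β → ℝ} {t s : ℝ}
    {f : Fin 2 → Fin 2 → α → ℝ} {g : Fin 2 → Fin 2 → β → ℝ} {h : Fin 2 → α → β → ℝ}
    (hA : IsFKGMeasure wA) (hB : IsFKGMeasure wB) (ht0 : 0 < t) (ht1 : t < 1) (hs0 : 0 < s) (hs1 : s < 1)
    (hf0 : ∀ z c a, 0 ≤ f z c a) (hfa : ∀ z c, Monotone (f z c)) (hfc : ∀ z a, Monotone (fun c => f z c a))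
    (hfdom : ∀ a, f 0 1 a ≤ f 1 0 a)
    (hg0 : ∀ z c b, 0 ≤ g z c b) (hgb : ∀ z c, Monotone (g z c)) (hgc : ∀ z b, Monotone (fun c => g z c b))
    (hgdom : ∀ b, g 0 1 b ≤ g 1 0 b)
    (hh0 : ∀ z a b, 0 ≤ h z a b) (hhz : ∀ a b, Monotone (fun z => h z a b))
    (hha : ∀ z b, Monotone (fun a => h z a b)) (hhb : ∀ z a, Monotone (h z a)) :
    0 ≤ sahiE (fun q : α × β × (Fin 2 × Fin 2) => wA q.1 * wB q.2.1 *
          ((if q.2.2.1 = 1 then t else 1 - t) * (if q.2.2.2 = 1 then s else 1 - s))) 3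
        ![fun q => f q.2.2.1 q.2.2.2 q.1, fun q => g q.2.2.1 q.2.2.2 q.2.1, fun q => h q.2.2.1 q.1 q.2.1] := by
  refine sahiE_three_nonneg_T1_zdom (wC := fun x : Fin 2 × Fin 2 => (if x.1 = 1 then t else 1 - t) * (if x.2 = 1 then s else 1 - s))
    hA hB ?_ ?_ hf0 hfa hfc hfdom hg0 hgb hgc hgdom hh0 hhz hha hhb
  · intro x
    apply mul_pos
    · split_ifs <;> linarith
    · split_ifs <;> linarith
  · rw [Fintype.sum_prod_type]
    simp only [Fin.sum_univ_two, Fin.isValue]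
    simp only [show ((0 : Fin 2) = 1) = False from by decide, if_false, if_true]
    ring

end SahiT1Lex

end Summit.CriticalPhenomena.PercolationContinuityZ3.Theorems
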